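import Literature.Topology.FourManifolds.KhResolutions

/-!
# Sanity lemmas for the reconnection relation `GaussDiagram.stateAdj` — pub-sp4mp REVIEW-RUNBOOK

Review evidence only (ops-runbook sanity registry `registry/pub-sp4mp.json`); no new definitions.
`G.stateAdj σ a b` (`Literature/Topology/FourManifolds/KhResolutions.lean`) relates two DISTINCT arcs
of the based circle that are glued end to end by the smoothing `σ` at some chord (Seifert chord:
`arcIn p ~ arcOut (partner p)`; non-Seifert chord: `arcIn p ~ arcIn (partner p)` and
`arcOut p ~ arcOut (partner p)`).  All instances below are by `decide` on the accepted literals `kink 1`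
(one positive chord, marked points `0 1`, arcs `0 1`) and `trefoilDiagram` (over-passages at `0 2 4`,
under-passages at `3 5 1`, arcs `0 … 5`); arcs are written `⟨k, _⟩ : G.Arc = Fin G.arcCount`.

* HOLDS: in the positive kink the NON-Seifert smoothing (`σ = 1`) glues arc `1` to arc `0`
  (one circle, `circleCount_kink_true`); in the Seifert state `σ ≡ 0` of the trefoil, chord `0`
  (`0 ↔ 3`) glues the arc entering `0` (arc `5`) to the arc leaving `3` (arc `3`); in the state `σ ≡ 1`
  it glues arc `5` to arc `2` (`= arcIn 3`) instead.
* FAILS: in the Seifert state of the kink every end is reconnected to the SAME arc (loops are discarded by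
  the clause `a ≠ b`), so the relation is EMPTY — two circles, `circleCount_kink_false`; in the trefoil's
  Seifert state the consecutive arcs `0`, `1` are not glued; the relation is irreflexive for every diagram.
-/

namespace Summit.SmoothPoincare4.Runbook

open Literature.Topology.FourManifolds GaussDiagram

/-! ## The relation is irreflexive (loops discarded) -/

/-- `stateAdj` is irreflexive: the clause `a ≠ b` discards the loops that arise when the two ends of a
chord are adjacent marked points. -/
theorem stateAdj_irrefl (G : GaussDiagram) (σ : G.State) (a : G.Arc) : ¬ G.stateAdj σ a a :=
  fun h ↦ h.1 rfl

/-! ## The positive kink `kink 1` (arcs `0`, `1`) -/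

/-- HOLDS: in the non-Seifert state (`1`-smoothing at the positive crossing) arc `1` (entering the
over-passage `0`) is glued to arc `0` (entering its partner `1`): the two arcs form ONE circle. -/
theorem kink_stateAdj_true :
    (kink 1).stateAdj (fun _ ↦ true) ⟨1, by decide⟩ ⟨0, by decide⟩ := by
  decide

/-- … and symmetrically arc `0` to arc `1`. -/
theorem kink_stateAdj_true_symm :
    (kink 1).stateAdj (fun _ ↦ true) ⟨0, by decide⟩ ⟨1, by decide⟩ := by
  decide

/-- FAILS: in the Seifert state (`0`-smoothing at the positive crossing) the strand entering `0` continues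
along the strand leaving `1`, which is the same arc `1`, and likewise at the other end: both reconnections
are loops, discarded — NO two distinct arcs are related, the two arcs are two circles
(`circleCount_kink_false = 2`). -/
theorem kink_not_stateAdj_false (a b : (kink 1).Arc) : ¬ (kink 1).stateAdj (fun _ ↦ false) a b := by
  revert a b
  decide

/-! ## The right-handed trefoil `trefoilDiagram` (arcs `0 … 5`) -/

/-- HOLDS: in the Seifert state `σ ≡ 0` (all crossings positive, all smoothings Seifert's), chord `0`
joins the marked points `0` (over) and `3` (under): the arc entering `0` (arc `5`) is glued to the arc
leaving `3` (arc `3`). -/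
theorem trefoil_stateAdj_false_5_3 :
    trefoilDiagram.stateAdj (fun _ ↦ false) ⟨5, by decide⟩ ⟨3, by decide⟩ := by
  decide

/-- FAILS: in the same state the consecutive arcs `0` and `1` (which meet at the marked point `1`, the
under-passage of chord `2`) are NOT glued to each other. -/
theorem trefoil_not_stateAdj_false_0_1 :
    ¬ trefoilDiagram.stateAdj (fun _ ↦ false) ⟨0, by decide⟩ ⟨1, by decide⟩ := by
  decide

/-- HOLDS (non-Seifert rule): in the state `σ ≡ 1` chord `0` glues the arc entering `0` (arc `5`) to the
arc entering its partner `3` (arc `2`) — the orientation-reversing reconnection. -/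
theorem trefoil_stateAdj_true_5_2 :
    trefoilDiagram.stateAdj (fun _ ↦ true) ⟨5, by decide⟩ ⟨2, by decide⟩ := by
  decide

/-- … whereas the Seifert gluing `5 ~ 3` of `trefoil_stateAdj_false_5_3` is then absent. -/
theorem trefoil_not_stateAdj_true_5_3 :
    ¬ trefoilDiagram.stateAdj (fun _ ↦ true) ⟨5, by decide⟩ ⟨3, by decide⟩ := by
  decide

end Summit.SmoothPoincare4.Runbook
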